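import Literature.NumberTheory.EllipticCurves.Kato2004.IwasawaH1LayerEigenfunctionalTwistZetaTwoProofs
import Literature.NumberTheory.EllipticCurves.Kato2004.ZetaLineRankOneRigidityFinsetProofs
import Literature.NumberTheory.EllipticCurves.Kato2004.EulerSystemValuesNegOneTwistPair
import Literature.NumberTheory.EllipticCurves.Kato2004.EulerSystemBoundFineSelmerTwo
import Summits.BirchSwinnertonDyer.BirchSwinnertonDyer.Theorems.CyclotomicUntwistRohrlichAtLevel
import HarnessLib

/-!
# Route ByReductionTypeAtTwo, crux `AdditiveRankZeroAtTwo` (stmt-BirchSwinnertonDyer-19098), child C4″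
# (stmt-BirchSwinnertonDyer-22618) — reading step T22 (b) of the descent sockets, ODD-BRANCH SIDE: the transported zeta line `Λ·ỹ`
# (`ỹ` = the odd-branch transport of Kato's family of `f_{W′}`, `W′ = W^{(−1)}`) and Kato's line `Λ·y` of `f_W` AGREE at every
# height-one prime `𝔮 ∌ 2` of `Λ` — a THEOREM modulo ONE construction fact (`Kato2004.exists_eulerSystem_expStar_values_negOneTwistPair_two`)
# and Kato Thm. 12.4 (2) (`Kato2004.thm12_4`); Rohrlich fed from the kernel

Cell `bsd-2adic` (run/shared/lean/pub/bsd-2adic/), seat `bsd-2adic-addL2x` GEN 21 (repair-census entry R-B84 (1) = R-B83 (1), pen word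
RC-507). The sockets' step T22 (b) («`Z̃` and Kato's `Z(f_W)` agree at every height-one `𝔮 ∌ 2`», module docstring of
`…AdditiveKatoDescentSocketDefs.lean`) is the conclusion of the rigidity theorem
`Kato2004.IwasawaH1Data.lengthAt_quotient_span_eq_of_layerFunctionals{,_finset}` (GEN 19 p741570 / GEN 21 p747070) whose hypothesis `hw`
asks, for every primitive even `χ` off a finite set, for ONE finite-level eigenfunctional `w` with `w(proj_n z) ≠ 0` (Kato side,
GEN 20 `…AdditiveKatoLayerEigenfunctionalsAtTwo`) AND `w(proj_n z̃) = ρ·w(proj_n z)` (odd-branch side). THIS FILE discharges BOTH for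
the classes this route means: `y` = the Λ-adic lift of Kato's guarded family of `f_W`; `ỹ` = the Λ-adic lift of
`(Cor_{ℚ(μ_{2^{n+2}})/ℚ_n} u_* z′_{n+2,∅})_n`, `z′` Kato's guarded family of `f′ = f_{W′}`, `u : T₂W′ ≃ T₂W` the twist identification —
VERBATIM the class «`Z = Λ·cor(z_γ^{(2)}(f′))`, transported» of the construction fact
`Kato2004.exists_splitTwistDivisibilityInputsDescent_negOne_two` (`SplitTwistDivisibilityInputsDescent.Z`) read on a `ZetaBody` witness — from
the tree's Literature theorems of this GEN: `Kato2004.exists_finsets_forall_layerEigenfunctional_twistLift_two` (p748434: the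
eigenfunctionals are GEN 20's `χ`-weighted dual-exponential sums; the value on `ỹ` through the LINK `Λ(u_* y′) = (1 ⊗ i_m)Λ′(y′)`, the
identity `L_{(2AM)}(f′, ψχ₄, s) = L_{(2AM)}(f_W, ψ, s)`, Kato's pair datum, one period ratio `ρ₀ ∈ ℚ(ζ_{M₀})` seen through finitely many
field embeddings `ℚ(ζ_{M₀}) → ℂ₂`), `Kato2004.IwasawaH1Data.existsUnique_twistLift_of_zetaBody_two` (p747450), the finite-ratio rigidity
(p747070), `Kato2004.zetaBody_lift_ne_zero_of_rohrlich_two`, `Kato2004.exists_katoPairDatum` (p747865), with Rohrlich's finiteness the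
KERNEL theorem `PSRohrlichAtLevel.rohrlich_primePow_of_isNewformOf` (any prime; `2 ∣ N` allowed):

* `AddKatoTwo.lengthAt_quotient_twistLift_eq_of_zetaBodyPair` — the UNIVERSAL form: for ANY two `ZetaBody` witnesses over ONE pair datum
  linked through `u` (the shape produced by the pair fact), the lifts `y`, `ỹ` satisfy `ℓ_𝔮(𝐇¹/Λỹ) = ℓ_𝔮(𝐇¹/Λy)` at every prime
  `𝔮 ∌ 2` of `Λ`, GRANTED `Kato2004.thm12_4`;
* `AddKatoTwo.exists_oddBranchLine_eq_kato_line` — GRANTED `Kato2004.exists_eulerSystem_expStar_values_negOneTwistPair_two` and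
  `Kato2004.thm12_4`, for `W[2]` irreducible: there are a genuine `2`-adic Euler-system class `y ≠ 0` (`Kato2004.IsEulerSystemClassTwo`) and
  a class `ỹ ≠ 0` which IS the odd-branch transport of an Euler system for `T₂W′` along a level-equivariant `u : T₂W′ ≃ T₂W`, such that
  `ℓ_𝔮(𝐇¹_Γ(T₂W)/Λỹ) = ℓ_𝔮(𝐇¹_Γ(T₂W)/Λy)` at every height-one/any prime `𝔮 ∌ 2`.

WHAT REMAINS A READING in T22 after this file (named precisely): (b) — NOTHING beyond the ONE construction fact and Thm. 12.4 (2)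
(the identification of the socket package's abstract `Z` with `Λ·ỹ` is part of reading (a): the two-sided (17.13.1) package with
`H2 := J.H2` and `Z` pinned to a `ZetaBody` of `f′`, GEN 18 §4 (2)); (a) — unchanged. HONEST FRAMING (D-0036/D-0054): theorems only,
conditional on the named facts (hypotheses BY NAME, never asserted); closes nothing; nothing booked; the sockets stay `@[conjecture]`
(MEMO tier); BSD is not proved by any of this.

References: [Kato2004Asterisque] Thm. 12.4 (2), Thm. 12.5 (1)(2) (pp. 221–222), Thm. 12.6 (p. 222), 12.1 (pp. 219–220), §13.8 (p. 228),
13.5 (2) (p. 227), Thm. 9.7, Thm. 6.6 (1); [RohrlichInventiones1984]; [SilvermanAEC2009] X.5 Cor. 5.4, Ex. 10.16; [Rubin2000] Ch. VI;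
[MazurTateTeitelbaum1986Invent] §I.12–I.14; [Washington1997] §7.1, §13.1; memo run/shared/lean/pub/bsd-2adic/addL2x/VERDICT-19098-addL2x-GEN21.md.
-/

set_option autoImplicit false
-- the summit's namespace `Summit.BirchSwinnertonDyer.BirchSwinnertonDyer` (Sub = Summit) trips `dupNamespace`
set_option linter.dupNamespace false

noncomputable section

open scoped NumberField TensorProduct

namespace Summit.BirchSwinnertonDyer.BirchSwinnertonDyer.Theorems.AddKatoTwo

open Field CongruenceSubgroup WeierstrassCurve IsDedekindDomain Literature.NumberTheory.GaloisRepresentations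
  Literature.NumberTheory.EllipticCurves Literature.NumberTheory.EllipticCurves.ModularForms
  Literature.NumberTheory.EllipticCurves.Kato2004 Literature.NumberTheory.EllipticCurves.Kato2004.EulerSystemValues

variable {W : WeierstrassCurve ℚ} [W.IsElliptic] [ContinuousSMul ℤ_[2] (W.tateModule 2)]
  [Module.Free ℤ_[2] (W.tateModule 2)] [Module.Finite ℤ_[2] (W.tateModule 2)]
  [(W.quadraticTwist (-1)).IsElliptic] [ContinuousSMul ℤ_[2] ((W.quadraticTwist (-1)).tateModule 2)]
  [Module.Free ℤ_[2] ((W.quadraticTwist (-1)).tateModule 2)] [Module.Finite ℤ_[2] ((W.quadraticTwist (-1)).tateModule 2)]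
  {κ : ZpExtension ℚ 2} {γ : absoluteGaloisGroup ℚ} (I : Kato2004.IwasawaH1Data W 2 κ γ)

/-- **T22 (b), universal form: for ANY linked pair of `ZetaBody` witnesses the transported line and Kato's line agree away from `2`.**
Data: `W/ℚ` elliptic, `W′ = W^{(−1)}`, newforms `f`, `f′`; `ZetaBody W 2 f ι κ₀ Λ c d a A z x` and `ZetaBody W′ 2 f′ ι κ₀′ Λ′ c d a′ A z′ x′` over ONE
pair datum (`(c,12A) = (d,12N) = (d,12N′) = 1`, `c ≡ d ≡ 1 (mod A)` and `(mod 4)`, `c, d > 1`, `[a/A]⁻_f ≠ 0`, `[a′/A]⁺_{f′} ≠ 0`);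
`u : T₂W′ ≃ T₂W` continuous, equivariant on the levels `k ≥ 2` and LINKED: `Λ(u_* y₁) = (1 ⊗ i_m)Λ′(y₁)`; `κ` cyclotomic with topological
generator `γ`; a pin `I`; `y` with `proj_n y = Cor z_{n+2,∅}` and `ỹ` with `proj_n ỹ = Cor u_* z′_{n+2,∅}`. Then, GRANTED `Kato2004.thm12_4`,
`ℓ_𝔮(𝐇¹/Λỹ) = ℓ_𝔮(𝐇¹/Λy)` at every prime `𝔮 ∌ 2` of `Λ` (Rohrlich from the kernel; `y ≠ 0`; the finite-ratio rigidity with the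
eigenfunctionals of `exists_finsets_forall_layerEigenfunctional_twistLift_two`).
[cite: Kato2004Asterisque, Thm. 12.4 (2), Thm. 12.5 (1)(2) (pp. 221–222), 13.5 (2) (p. 227), Thm. 12.6 (p. 222)] [cite: RohrlichInventiones1984, Theorem (p. 409)] -/
theorem lengthAt_quotient_twistLift_eq_of_zetaBodyPair (h12 : Kato2004.thm12_4) (hκ : κ.IsCyclotomic) (hγ : κ.IsTopGenerator γ)
    {N N' : ℕ} [NeZero N] [NeZero N'] {f : CuspForm (Gamma0 N) 2} {f' : CuspForm (Gamma0 N') 2}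
    {ι : (m : ℕ) → (CyclotomicField m ℚ →+* ℂ)} {κ₀ κ₀' : ℝ}
    {Λ : ∀ (k : ℕ) (r : Finset (HeightOneSpectrum (𝓞 ℚ))),
      H1 (tateRep W 2) (cycSubgroup 2 k r) →ₗ[ℤ_[2]] ℚ_[2] ⊗[ℚ] CyclotomicField (cycLevel 2 k r) ℚ}
    {Λ' : ∀ (k : ℕ) (r : Finset (HeightOneSpectrum (𝓞 ℚ))),
      H1 (tateRep (W.quadraticTwist (-1)) 2) (cycSubgroup 2 k r) →ₗ[ℤ_[2]] ℚ_[2] ⊗[ℚ] CyclotomicField (cycLevel 2 k r) ℚ}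
    {c d a a' : ℤ} {A : ℕ}
    {z : ∀ (k : ℕ) (r : (cyclotomicLevelsRat 2 (badPlaces c d A N)).Ideals),
      H1 (tateRep W 2) ((cyclotomicLevelsRat 2 (badPlaces c d A N)).level k r.1)}
    {x : ∀ (k : ℕ) (r : (cyclotomicLevelsRat 2 (badPlaces c d A N)).Ideals), CyclotomicField (cycLevel 2 k r.1) ℚ}
    {z' : ∀ (k : ℕ) (r : (cyclotomicLevelsRat 2 (badPlaces c d A N')).Ideals),
      H1 (tateRep (W.quadraticTwist (-1)) 2) ((cyclotomicLevelsRat 2 (badPlaces c d A N')).level k r.1)}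
    {x' : ∀ (k : ℕ) (r : (cyclotomicLevelsRat 2 (badPlaces c d A N')).Ideals), CyclotomicField (cycLevel 2 k r.1) ℚ}
    (hbody : ZetaBody W 2 f ι κ₀ Λ c d a A z x) (hbody' : ZetaBody (W.quadraticTwist (-1)) 2 f' ι κ₀' Λ' c d a' A z' x')
    (hf : IsNewformOf W f) (hf' : IsNewformOf (W.quadraticTwist (-1)) f') (hκ₀ : κ₀ ≠ 0) (hκ₀' : κ₀' ≠ 0) (hA : 0 < A)
    (hc : Int.gcd c (6 * 2 * A) = 1) (hd : Int.gcd d (6 * 2 * N) = 1) (hd' : Int.gcd d (6 * 2 * N') = 1)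
    (hcA : (A : ℤ) ∣ c - 1) (hdA : (A : ℤ) ∣ d - 1) (hc4 : (4 : ℤ) ∣ c - 1) (hd4 : (4 : ℤ) ∣ d - 1) (hc1 : 1 < c) (hd1 : 1 < d)
    (ha : ratMinusSymbol f ((a : ℚ) / A) ≠ 0) (ha' : ratPlusSymbol f' ((a' : ℚ) / A) ≠ 0)
    (u : (W.quadraticTwist (-1)).tateModule 2 ≃ₗ[ℤ_[2]] W.tateModule 2) (hu : Continuous u)
    (hV : ∀ k : ℕ, 2 ≤ k → ∀ (r : Finset (HeightOneSpectrum (𝓞 ℚ))) (σ : absoluteGaloisGroup ℚ),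
      σ ∈ cycSubgroup 2 k r → ∀ t : (W.quadraticTwist (-1)).tateModule 2, u (σ • t) = σ • u t)
    (hlink : ∀ (k : ℕ) (hk : 2 ≤ k) (r : Finset (HeightOneSpectrum (𝓞 ℚ))) (i : CyclotomicField (cycLevel 2 k r) ℚ),
      ι (cycLevel 2 k r) i = Complex.I →
      ∀ y₁ : H1 (tateRep (W.quadraticTwist (-1)) 2) (cycSubgroup 2 k r),
        Λ k r (twistH1On W (W.quadraticTwist (-1)) u hu (hV k hk r) y₁) = ((1 : ℚ_[2]) ⊗ₜ[ℚ] i) * Λ' k r y₁)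
    {y : I.H} (hy : ∀ n : ℕ, I.proj n y = levelToLayerTwo W hκ (badPlaces c d A N) n
      (z (n + 2) (cyclotomicLevelsRat 2 (badPlaces c d A N)).idealOne))
    {y' : I.H} (hy' : ∀ n : ℕ, I.proj n y' = levelToLayerTwo W hκ (badPlaces c d A N') n
      (twistH1On W (W.quadraticTwist (-1)) u hu
        (equivariant_level_of_cycSubgroup W (W.quadraticTwist (-1)) u hV (badPlaces c d A N') n)
        (z' (n + 2) (cyclotomicLevelsRat 2 (badPlaces c d A N')).idealOne)))
    (𝔮 : PrimeSpectrum (IwasawaAlgebra 2)) (hp𝔮 : PowerSeries.C (2 : ℤ_[2]) ∉ 𝔮.asIdeal) :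
    Module.lengthAt (IwasawaAlgebra 2) (I.H ⧸ Submodule.span (IwasawaAlgebra 2) {y'}) 𝔮 =
      Module.lengthAt (IwasawaAlgebra 2) (I.H ⧸ Submodule.span (IwasawaAlgebra 2) {y}) 𝔮 := by
  have hR := PSRohrlichAtLevel.rohrlich_primePow_of_isNewformOf (p := 2) hf
  have hy0 : y ≠ 0 := Kato2004.zetaBody_lift_ne_zero_of_rohrlich_two hbody hf hκ₀ hA hc hd hcA hdA hc1 hd1 ha hκ hy hR
  obtain ⟨S, P, hP, hw⟩ := Kato2004.exists_finsets_forall_layerEigenfunctional_twistLift_two (I := I) u hu hV hbody hbody' hf hf'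
    hκ₀ hκ₀' hA hc hd hd' hcA hdA hc4 hd4 hc1 hd1 ha ha' hlink hκ hγ hy hy' hR
  exact Kato2004.IwasawaH1Data.lengthAt_quotient_span_eq_of_layerFunctionals_finset I h12 hκ hγ hy0 P hP S
    (fun m hm χ hχp hχe _ hS ↦ hw m hm χ hχp hχe hS) 𝔮 hp𝔮

/-- **T22 (b) at `p = 2` from the ONE construction fact, `W[2]` irreducible: the odd-branch transported zeta line and Kato's zeta line of
`f_W` agree at every prime `𝔮 ∌ 2` of `Λ`.** For `W/ℚ` elliptic with `W[2]` irreducible, newforms `f` of `W` and `f′` of `W′ = W^{(−1)}`,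
`κ` cyclotomic with topological generator `γ`, any pin `I`: GRANTED `Kato2004.exists_eulerSystem_expStar_values_negOneTwistPair_two` and
`Kato2004.thm12_4`, there are `y, ỹ ∈ 𝐇¹_Γ(T₂W)` — `y` a genuine `2`-adic Euler-system class (`Kato2004.IsEulerSystemClassTwo`) `≠ 0` (the
lift of Kato's family of `f_W`), `ỹ ≠ 0` THE ODD-BRANCH TRANSPORT of an Euler system `z′` for `T₂W′` (Kato's family of `f′`) along a
continuous `ℤ₂`-identification `u : T₂W′ ≃ T₂W` equivariant on every level `Gal(ℚ̄/ℚ(μ_{2^k·∏ℓ}))`, `k ≥ 2`: `proj_n ỹ =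
Cor_{ℚ(μ_{2^{n+2}})/ℚ_n}(u_* z′_{n+2,∅})` for all `n` — with `ℓ_𝔮(𝐇¹_Γ(T₂W)/Λỹ) = ℓ_𝔮(𝐇¹_Γ(T₂W)/Λy)` at every prime `𝔮 ∌ 2` of `Λ`. This is
the sockets' T22 (b) «`Z̃` and `Z(f_W)` agree at every height-one `𝔮 ∌ 2`» for `Z̃ = Λỹ`, `Z = Λy`; Rohrlich is the kernel theorem
`PSRohrlichAtLevel.rohrlich_primePow_of_isNewformOf`. [cite: Kato2004Asterisque, Thm. 12.4 (2), Thm. 12.5 (1)(2) (pp. 221–222), Thm. 12.6 (p. 222), 12.1 (pp. 219–220), 13.5 (2) (p. 227)]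
[cite: SilvermanAEC2009, X.5 Cor. 5.4] [cite: Rubin2000, Ch. VI] -/
theorem exists_oddBranchLine_eq_kato_line (hκ : κ.IsCyclotomic) (hγ : κ.IsTopGenerator γ)
    (hPair : Kato2004.exists_eulerSystem_expStar_values_negOneTwistPair_two) (h12 : Kato2004.thm12_4)
    (hirr : W.HasIrreducibleModPGaloisRep 2) {N : ℕ} [NeZero N] (f : CuspForm (Gamma0 N) 2) (hf : IsNewformOf W f)
    {N' : ℕ} [NeZero N'] (f' : CuspForm (Gamma0 N') 2) (hf' : IsNewformOf (W.quadraticTwist (-1)) f') :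
    ∃ y y' : I.H, Kato2004.IsEulerSystemClassTwo W hκ I y ∧ y ≠ 0 ∧ y' ≠ 0 ∧
      (∃ (u : (W.quadraticTwist (-1)).tateModule 2 ≃ₗ[ℤ_[2]] W.tateModule 2) (hu : Continuous u)
        (hV : ∀ k : ℕ, 2 ≤ k → ∀ (r : Finset (HeightOneSpectrum (𝓞 ℚ))) (σ : absoluteGaloisGroup ℚ),
          σ ∈ cycSubgroup 2 k r → ∀ t : (W.quadraticTwist (-1)).tateModule 2, u (σ • t) = σ • u t)
        (S : Set (HeightOneSpectrum (𝓞 ℚ)))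
        (z' : ∀ (k : ℕ) (r : (cyclotomicLevelsRat 2 S).Ideals), H1 (tateRep (W.quadraticTwist (-1)) 2) ((cyclotomicLevelsRat 2 S).level k r.1)),
        IsEulerSystem (cyclotomicLevelsRat 2 S) (tateRep (W.quadraticTwist (-1)) 2) 2 z' ∧
        ∀ n : ℕ, I.proj n y' = levelToLayerTwo W hκ S n
          (twistH1On W (W.quadraticTwist (-1)) u hu (equivariant_level_of_cycSubgroup W (W.quadraticTwist (-1)) u hV S n)
            (z' (n + 2) (cyclotomicLevelsRat 2 S).idealOne))) ∧
      ∀ (𝔮 : PrimeSpectrum (IwasawaAlgebra 2)), PowerSeries.C (2 : ℤ_[2]) ∉ 𝔮.asIdeal →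
        Module.lengthAt (IwasawaAlgebra 2) (I.H ⧸ Submodule.span (IwasawaAlgebra 2) {y'}) 𝔮 =
          Module.lengthAt (IwasawaAlgebra 2) (I.H ⧸ Submodule.span (IwasawaAlgebra 2) {y}) 𝔮 := by
  set ι : (m : ℕ) → (CyclotomicField m ℚ →+* ℂ) :=
    fun m ↦ Classical.choice (inferInstance : Nonempty (CyclotomicField m ℚ →+* ℂ)) with hι
  obtain ⟨u, hu, hV, κ₀, hκ₀, κ₀', hκ₀', Λ, Λ', hlink, hfamW, hfamT⟩ := hPair W hirr f hf f' hf' ι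
  obtain ⟨c, d, a, a', A, hA, hc, hd, hd', hcA, hdA, hc4, hd4, hc1, hd1, ha, ha'⟩ :=
    Kato2004.exists_katoPairDatum f hf.1 hf.coeffField_eq_bot f' hf'.1 hf'.coeffField_eq_bot 2
  obtain ⟨z, x, hbody⟩ := hfamW c d a A hA hc hd
  obtain ⟨z', x', hbody'⟩ := hfamT c d a' A hA hc hd'
  have hne := Kato2004.two_mul_natAbs_ne_zero_of_guards 2 hA (NeZero.ne N) hc hd
  obtain ⟨y, hyES, hy⟩ := Kato2004.exists_isEulerSystemClassTwo_of_zetaBody W hκ I f ι κ₀ Λ c d a A z x hbody hne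
  obtain ⟨y', hy', -⟩ := Kato2004.IwasawaH1Data.existsUnique_twistLift_of_zetaBody_two W (W.quadraticTwist (-1)) u hu hκ I hV f' ι
    κ₀' Λ' c d a' A z' x' hbody'
  have hR := PSRohrlichAtLevel.rohrlich_primePow_of_isNewformOf (p := 2) hf
  have hy0 : y ≠ 0 := Kato2004.zetaBody_lift_ne_zero_of_rohrlich_two hbody hf hκ₀ hA hc hd hcA hdA hc1 hd1 ha hκ hy hR
  have hlen : ∀ (𝔮 : PrimeSpectrum (IwasawaAlgebra 2)), PowerSeries.C (2 : ℤ_[2]) ∉ 𝔮.asIdeal →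
      Module.lengthAt (IwasawaAlgebra 2) (I.H ⧸ Submodule.span (IwasawaAlgebra 2) {y'}) 𝔮 =
        Module.lengthAt (IwasawaAlgebra 2) (I.H ⧸ Submodule.span (IwasawaAlgebra 2) {y}) 𝔮 := fun 𝔮 hp𝔮 ↦
    lengthAt_quotient_twistLift_eq_of_zetaBodyPair I h12 hκ hγ hbody hbody' hf hf' hκ₀ hκ₀' hA hc hd hd' hcA hdA hc4 hd4 hc1 hd1
      ha ha' u hu hV hlink hy hy' 𝔮 hp𝔮
  -- `ỹ ≠ 0`: some layer value `w(proj_n ỹ) = ρ · w(proj_n y)` with `ρ ≠ 0`, `w(proj_n y) ≠ 0`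
  obtain ⟨S, P, hP, hw⟩ := Kato2004.exists_finsets_forall_layerEigenfunctional_twistLift_two (I := I) u hu hV hbody hbody' hf hf'
    hκ₀ hκ₀' hA hc hd hd' hcA hdA hc4 hd4 hc1 hd1 ha ha' hlink hκ hγ hy hy' hR
  have hy'0 : y' ≠ 0 := by
    intro h0
    -- every character point `ζ − 1` (`ζ` of exact `2`-power order) would lie in the finite set `S`
    have key : ∀ j : ℕ, ∃ t ∈ S, ∃ ζ : ℂ_[2], IsPrimitiveRoot ζ (2 ^ (j + 1)) ∧ t = ζ - 1 := by
      intro j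
      obtain ⟨ζ, hζ⟩ := HasEnoughRootsOfUnity.exists_primitiveRoot ℂ_[2] (2 ^ (j + 1))
      obtain ⟨χ, hχp, hχe, -, hχγ⟩ := exists_character_apply_cyclotomicGenerator_eq (p := 2) j hζ
      by_cases hS : (χ (cyclotomicGenerator 2 : ZMod (2 ^ (j + 1 + cyclotomicExponent 2))) - 1) ∈ S
      · exact ⟨_, hS, ζ, hζ, by rw [hχγ]⟩
      · exfalso
        obtain ⟨n, w, -, -, -, hwz, ρ, hρP, hprop⟩ := hw (j + 1 + cyclotomicExponent 2) (by omega) χ hχp hχe hS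
        have hρ0 : ρ ≠ 0 := fun h ↦ hP (h ▸ hρP)
        have hzero : ρ * w (I.proj n y) = 0 := by rw [← hprop, h0, map_zero, map_zero]
        exact hwz ((mul_eq_zero.mp hzero).resolve_left hρ0)
    choose t ht ζ hζ htζ using key
    have hinj : Function.Injective t := by
      intro j₁ j₂ h
      have h' : ζ j₁ = ζ j₂ := by
        have e₁ := htζ j₁
        have e₂ := htζ j₂
        have : ζ j₁ - 1 = ζ j₂ - 1 := by rw [← e₁, ← e₂, h]
        exact sub_left_injective this
      have hpow : 2 ^ (j₁ + 1) = 2 ^ (j₂ + 1) := by rw [(hζ j₁).eq_orderOf, (hζ j₂).eq_orderOf, h']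
      have := Nat.pow_right_injective (le_refl 2) hpow
      omega
    exact Set.infinite_range_of_injective hinj (S.finite_toSet.subset (by rintro _ ⟨j, rfl⟩; exact ht j))
  exact ⟨y, y', hyES, hy0, hy'0, ⟨u, hu, hV, badPlaces c d A N', z', hbody'.1, hy'⟩, hlen⟩

end Summit.BirchSwinnertonDyer.BirchSwinnertonDyer.Theorems.AddKatoTwo

end
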